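import Mathlib.Algebra.Module.CharacterModule
import Mathlib.NumberTheory.Padics.RingHoms
import Mathlib.Algebra.Polynomial.Monomial
import HarnessLib

/-!
# `ℤ_p`-valued functionals separate `N / p^k N` for a `p`-torsion-free abelian group `N`
# (Pontryagin duality for the pair `N ⊗ ℚ_p/ℤ_p`, `Hom(N, ℤ_p)`)

Topic `Algebra/Module`; namespace `Literature.Algebra.Module`; THEOREMS ONLY (no definition, no
named fact, no instance). Mathlib-only imports.

Let `p` be a prime and `N` an abelian group WITHOUT `p`-torsion (`p y = 0 ⇒ y = 0`). For `n ∈ N`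
and `k ≥ 0`:

* `exists_addMonoidHom_padicInt_not_dvd` — if `n ∉ p^k N` there is an additive map
  `z : N →+ ℤ_p` with `p^k ∤ z(n)`;
* `exists_nsmul_eq_of_forall_addMonoidHom_padicInt_dvd` — contrapositive: if `p^k ∣ z(n)` for EVERY
  additive `z : N →+ ℤ_p`, then `n = p^k y` for some `y`.

This is Pontryagin duality for the discrete torsion group `D = N ⊗ ℚ_p/ℤ_p = lim→ N/p^m N` and its
compact dual `Hom(D, ℚ/ℤ) = Hom_ℤ(N, ℤ_p)`: the image of `n ⊗ p^{-k}` in `D` is detected by characters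
of `D` [cite: NeukirchSchmidtWingberg2008, I §1 (1.1.8) (Pontryagin duality)], and a character of `D`
is the same as a compatible family of characters of the `N/p^m N`, i.e. an additive map `N → ℤ_p`.
Proof here (no topology): a character `χ` of `N/p^k N` with `χ(n) ≠ 0` exists because `ℚ/ℤ` is an
injective cogenerator (Mathlib `CharacterModule.exists_character_apply_ne_zero_of_ne_zero`); since
multiplication by `p` is injective on `N`, its dual is surjective on `Hom(N, ℚ/ℤ)`
(`CharacterModule.dual_surjective_of_injective`), so `χ` extends to a compatible tower
`θ_m : N → ℚ/ℤ`, `p^m θ_m = 0`, `p θ_{m+1} = θ_m`, `θ_k = χ`; the residues `θ_m(y) = a_m(y)/p^m`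
(`a_m(y) ∈ ℤ/p^m`) are compatible and assemble (Mathlib `PadicInt.lift` on `ℤ[X]`, `X ↦ a_m(y)`,
and `PadicInt.ext_of_toZModPow`) into `z(y) ∈ ℤ_p` with `z(y) ≡ a_m(y) (mod p^m)`, additive in `y`,
and `z(n) ≢ 0 (mod p^k)`.

USE (cell `bsd-ssimc`, seat `bsd-ssimc-k3c5-kdot-split` g6): the step "Taking Pontryagin duals, we
see that `r_p` is injective" of F. Sprung, Adv. Math. 449 (2024) 109741, §5.2, proof of Lemma 5.5
(p. 40), in the tree's transcription of `H¹_Iw(T)` as `ℤ_p`-valued functionals on local points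
(`Literature/NumberTheory/EllipticCurves/Sprung2012/ColemanMaps.lean`), consumed by
`Sprung2024/ChromaticLocalInjectivityProofs.lean`. Nothing specific to elliptic curves is used here.

## References
* [NeukirchSchmidtWingberg2008] J. Neukirch, A. Schmidt, K. Wingberg, *Cohomology of Number
  Fields*, 2nd ed., I §1 (1.1.8) (Pontryagin duality; characters separate points).
* [Sprung2024] F. Sprung, Adv. Math. 449 (2024) 109741, §5.2 p. 40.
-/

noncomputable section

open scoped Classical

namespace Literature.Algebra.Module

variable {N : Type*} [AddCommGroup N] {p : ℕ} [hp : Fact p.Prime]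

/-! ## §1 `p^m`-torsion elements of `ℚ/ℤ` and their residues in `ℤ/p^m` -/

/-- An element of `ℚ/ℤ = AddCircle (1 : ℚ)` killed by `p^m` is the class of `a / p^m` for an
integer `a`. [folklore] -/
private theorem exists_eq_coe_int_div_of_nsmul_eq_zero {m : ℕ} {u : AddCircle (1 : ℚ)}
    (hu : p ^ m • u = 0) : ∃ a : ℤ, u = (((a : ℚ) / (p : ℚ) ^ m : ℚ) : AddCircle (1 : ℚ)) := by
  induction u using QuotientAddGroup.induction_on with
  | H q =>
    change p ^ m • ((q : ℚ) : AddCircle (1 : ℚ)) = 0 at hu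
    rw [← AddCircle.coe_nsmul, AddCircle.coe_eq_zero_iff] at hu
    obtain ⟨a, ha⟩ := hu
    refine ⟨a, ?_⟩
    change ((q : ℚ) : AddCircle (1 : ℚ)) = _
    congr 1
    have hpm : ((p : ℚ) ^ m) ≠ 0 := pow_ne_zero _ (Nat.cast_ne_zero.mpr hp.out.ne_zero)
    rw [eq_div_iff hpm]
    rw [zsmul_eq_mul, mul_one, nsmul_eq_mul, Nat.cast_pow] at ha
    rw [ha, mul_comm]

/-- Two classes `a / p^m`, `b / p^m` agree in `ℚ/ℤ` iff `a ≡ b (mod p^m)`. [folklore] -/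
private theorem coe_int_div_eq_coe_int_div_iff {m : ℕ} {a b : ℤ} :
    ((((a : ℚ) / (p : ℚ) ^ m : ℚ)) : AddCircle (1 : ℚ)) = (((b : ℚ) / (p : ℚ) ^ m : ℚ)) ↔
      (a : ZMod (p ^ m)) = (b : ZMod (p ^ m)) := by
  have hpm : ((p : ℚ) ^ m) ≠ 0 := pow_ne_zero _ (Nat.cast_ne_zero.mpr hp.out.ne_zero)
  rw [← sub_eq_zero, ← AddCircle.coe_sub, ← sub_div, AddCircle.coe_eq_zero_iff,
    ZMod.intCast_eq_intCast_iff_dvd_sub a b (p ^ m)]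
  constructor
  · rintro ⟨c, hc⟩
    rw [zsmul_eq_mul, mul_one, eq_div_iff hpm] at hc
    refine ⟨-c, ?_⟩
    have h : ((c * (p : ℤ) ^ m : ℤ) : ℚ) = ((a - b : ℤ) : ℚ) := by push_cast; linarith
    have h' := (Int.cast_inj (α := ℚ)).mp h
    push_cast
    linarith
  · rintro ⟨c, hc⟩
    refine ⟨-c, ?_⟩
    rw [zsmul_eq_mul, mul_one, eq_div_iff hpm, Int.cast_neg]
    push_cast at hc
    have h : ((b - a : ℤ) : ℚ) = (((p : ℤ) ^ m * c : ℤ) : ℚ) := by rw [hc]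
    push_cast at h
    linarith

/-- **Residues.** A character `θ : N → ℚ/ℤ` killed by `p^m` has a unique additive "residue map"
`r : N → ℤ/p^m` with `θ(y) = r(y)/p^m`. [folklore] -/
private theorem exists_residue {m : ℕ} (θ : N →+ AddCircle (1 : ℚ)) (hθ : ∀ y, p ^ m • θ y = 0) :
    ∃ r : N →+ ZMod (p ^ m), ∀ (y : N) (a : ℤ),
      θ y = (((a : ℚ) / (p : ℚ) ^ m : ℚ) : AddCircle (1 : ℚ)) ↔ r y = (a : ZMod (p ^ m)) := by
  -- a choice of integer representatives
  have hex : ∀ y : N, ∃ a : ℤ, θ y = (((a : ℚ) / (p : ℚ) ^ m : ℚ) : AddCircle (1 : ℚ)) := fun y ↦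
    exists_eq_coe_int_div_of_nsmul_eq_zero (hθ y)
  choose a ha using hex
  have hchar : ∀ (y : N) (b : ℤ),
      θ y = (((b : ℚ) / (p : ℚ) ^ m : ℚ) : AddCircle (1 : ℚ)) ↔ (a y : ZMod (p ^ m)) = b := by
    intro y b
    rw [ha y]
    exact coe_int_div_eq_coe_int_div_iff
  refine ⟨{ toFun := fun y ↦ (a y : ZMod (p ^ m)), map_zero' := ?_, map_add' := fun y y' ↦ ?_ },
    fun y b ↦ hchar y b⟩
  · -- `θ 0 = 0 = 0 / p^m`
    have h := (hchar 0 0).mp (by rw [map_zero]; simp)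
    simpa using h
  · -- `θ (y + y') = (a y + a y') / p^m`
    have h : θ (y + y') = ((((a y + a y' : ℤ) : ℚ) / (p : ℚ) ^ m : ℚ) : AddCircle (1 : ℚ)) := by
      rw [map_add, ha y, ha y', ← AddCircle.coe_add, ← add_div, Int.cast_add]
    have h' := (hchar (y + y') (a y + a y')).mp h
    rw [Int.cast_add] at h'
    exact h'

/-! ## §2 The compatible tower of characters above a `p^k`-torsion character -/

omit hp in
/-- Multiplication by `p` on a `p`-torsion-free group is injective, so every character is `p` times
a character: `θ = p • θ'`, i.e. `θ(y) = θ'(p y)`. [folklore] -/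
private theorem exists_character_nsmul_eq (hN : ∀ y : N, p • y = 0 → y = 0)
    (θ : N →+ AddCircle (1 : ℚ)) : ∃ θ' : N →+ AddCircle (1 : ℚ), ∀ y, p • θ' y = θ y := by
  let f : N →ₗ[ℤ] N := (p : ℤ) • LinearMap.id
  have hf : Function.Injective f := by
    intro y y' h
    simp only [f, LinearMap.smul_apply, LinearMap.id_coe, id_eq, natCast_zsmul] at h
    rw [← sub_eq_zero] at h ⊢
    exact hN _ (by rw [smul_sub]; exact h)
  obtain ⟨θ', hθ'⟩ := CharacterModule.dual_surjective_of_injective f hf θ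
  refine ⟨θ', fun y ↦ ?_⟩
  have h := DFunLike.congr_fun hθ' y
  rw [CharacterModule.dual_apply] at h
  change θ' (f y) = θ y at h
  simp only [f, LinearMap.smul_apply, LinearMap.id_coe, id_eq, natCast_zsmul, map_nsmul] at h
  exact h

omit hp in
/-- The tower: characters `θ_m : N → ℚ/ℤ` (`m ≥ 0`) with `p^m θ_m = 0`, `p θ_{m+1} = θ_m` and
`θ_k = χ₀`, for a given `χ₀` killed by `p^k` on a `p`-torsion-free `N`. [folklore] -/
private theorem exists_tower (hN : ∀ y : N, p • y = 0 → y = 0) {k : ℕ}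
    (χ₀ : N →+ AddCircle (1 : ℚ)) (hχ₀ : ∀ y, p ^ k • χ₀ y = 0) :
    ∃ θ : ℕ → (N →+ AddCircle (1 : ℚ)), θ k = χ₀ ∧ (∀ m y, p ^ m • θ m y = 0) ∧
      ∀ m y, p • θ (m + 1) y = θ m y := by
  -- successive division by `p`
  have hdiv : ∀ θ : N →+ AddCircle (1 : ℚ), ∃ θ' : N →+ AddCircle (1 : ℚ), ∀ y, p • θ' y = θ y :=
    exists_character_nsmul_eq hN
  choose D hD using hdiv
  -- `ψ 0 = χ₀`, `ψ (j+1) = D (ψ j)`, so `p^j ψ_j = χ₀`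
  let ψ : ℕ → (N →+ AddCircle (1 : ℚ)) := fun j ↦ Nat.rec χ₀ (fun _ θ ↦ D θ) j
  have hψ0 : ψ 0 = χ₀ := rfl
  have hψs : ∀ j, ψ (j + 1) = D (ψ j) := fun _ ↦ rfl
  have hψpow : ∀ j y, p ^ j • ψ j y = χ₀ y := by
    intro j
    induction j with
    | zero => intro y; rw [pow_zero, one_smul, hψ0]
    | succ j ih => intro y; rw [pow_succ, mul_smul, hψs, hD, ih]
  -- `θ m := p^k • ψ m`
  refine ⟨fun m ↦ (DistribSMul.toAddMonoidHom (AddCircle (1 : ℚ)) (p ^ k)).comp (ψ m), ?_,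
    fun m y ↦ ?_, fun m y ↦ ?_⟩
  · ext y
    rw [AddMonoidHom.comp_apply, DistribSMul.toAddMonoidHom_apply, hψpow]
  · rw [AddMonoidHom.comp_apply, DistribSMul.toAddMonoidHom_apply, smul_smul, ← pow_add, add_comm,
      pow_add, mul_smul, hψpow, hχ₀]
  · rw [AddMonoidHom.comp_apply, DistribSMul.toAddMonoidHom_apply, AddMonoidHom.comp_apply,
      DistribSMul.toAddMonoidHom_apply, smul_comm, hψs, hD]

/-! ## §3 Assembling compatible residues into a `ℤ_p`-valued additive map -/

/-- **From a `p^k`-torsion character to a `ℤ_p`-valued functional.** For a `p`-torsion-free `N`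
and a character `χ₀ : N → ℚ/ℤ` with `p^k χ₀ = 0` there is an additive `z : N → ℤ_p` whose reduction
mod `p^k` recovers `χ₀`: `χ₀(y) = a/p^k ⟺ z(y) ≡ a (mod p^k)`.
[cite: NeukirchSchmidtWingberg2008, I §1 (1.1.8) (Pontryagin duality)] -/
theorem exists_addMonoidHom_padicInt_lift_character (hN : ∀ y : N, p • y = 0 → y = 0) {k : ℕ}
    (χ₀ : N →+ AddCircle (1 : ℚ)) (hχ₀ : ∀ y, p ^ k • χ₀ y = 0) :
    ∃ z : N →+ ℤ_[p], ∀ (y : N) (a : ℤ),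
      χ₀ y = (((a : ℚ) / (p : ℚ) ^ k : ℚ) : AddCircle (1 : ℚ)) ↔
        PadicInt.toZModPow k (z y) = (a : ZMod (p ^ k)) := by
  obtain ⟨θ, hθk, hθtors, hθsucc⟩ := exists_tower hN χ₀ hχ₀
  -- residues at every level
  have hres : ∀ m, ∃ r : N →+ ZMod (p ^ m), ∀ (y : N) (a : ℤ),
      θ m y = (((a : ℚ) / (p : ℚ) ^ m : ℚ) : AddCircle (1 : ℚ)) ↔ r y = (a : ZMod (p ^ m)) :=
    fun m ↦ exists_residue (θ m) (hθtors m)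
  choose r hr using hres
  -- compatibility of successive residues
  have hcompat1 : ∀ m y, ZMod.castHom (pow_dvd_pow p (Nat.le_succ m)) (ZMod (p ^ m)) (r (m + 1) y) =
      r m y := by
    intro m y
    obtain ⟨a, ha⟩ := exists_eq_coe_int_div_of_nsmul_eq_zero (hθtors (m + 1) y)
    have h1 : r (m + 1) y = (a : ZMod (p ^ (m + 1))) := (hr (m + 1) y a).mp ha
    have h2 : θ m y = (((a : ℚ) / (p : ℚ) ^ m : ℚ) : AddCircle (1 : ℚ)) := by
      have hp0 : (p : ℚ) ≠ 0 := Nat.cast_ne_zero.mpr hp.out.ne_zero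
      rw [← hθsucc m y, ha, ← AddCircle.coe_nsmul]
      congr 1
      rw [nsmul_eq_mul, pow_succ', ← mul_div_assoc, mul_div_mul_left _ _ hp0]
    have h3 : r m y = (a : ZMod (p ^ m)) := (hr m y a).mp h2
    rw [h1, h3, map_intCast]
  -- compatibility in general (integer-representative form, then cast form)
  have hstep : ∀ (m : ℕ) (y : N) (a : ℤ), r (m + 1) y = a → r m y = a := by
    intro m y a h
    rw [← hcompat1 m y, h, map_intCast]
  have hcompatInt : ∀ (d k1 : ℕ) (y : N) (a : ℤ), r (k1 + d) y = a → r k1 y = a := by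
    intro d
    induction d with
    | zero => intro k1 y a h; exact h
    | succ d ih => intro k1 y a h; exact ih k1 y a (hstep (k1 + d) y a h)
  have hcompat : ∀ (k1 k2 : ℕ) (hk : k1 ≤ k2) (y : N),
      ZMod.castHom (pow_dvd_pow p hk) (ZMod (p ^ k1)) (r k2 y) = r k1 y := by
    intro k1 k2 hk y
    obtain ⟨d, rfl⟩ := Nat.exists_eq_add_of_le hk
    obtain ⟨a, ha⟩ := ZMod.intCast_surjective (r (k1 + d) y)
    rw [← ha, map_intCast]
    exact (hcompatInt d k1 y a ha.symm).symm
  -- ring homomorphisms `ℤ[X] → ℤ/p^m`, `X ↦ r m y`, and their compatibility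
  let f : N → ∀ m : ℕ, Polynomial ℤ →+* ZMod (p ^ m) := fun y m ↦
    Polynomial.eval₂RingHom (Int.castRingHom (ZMod (p ^ m))) (r m y)
  have hfX : ∀ y m, f y m Polynomial.X = r m y := fun y m ↦ Polynomial.eval₂_X _ _
  have hfcompat : ∀ (y : N) (k1 k2 : ℕ) (hk : k1 ≤ k2),
      (ZMod.castHom (pow_dvd_pow p hk) (ZMod (p ^ k1))).comp (f y k2) = f y k1 := by
    intro y k1 k2 hk
    refine Polynomial.ringHom_ext (fun a ↦ by simp [f]) ?_
    rw [RingHom.comp_apply, hfX, hfX, hcompat k1 k2 hk y]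
  -- the `p`-adic integers `z y` and their residues
  let z : N → ℤ_[p] := fun y ↦ PadicInt.lift (hfcompat y) Polynomial.X
  have hz : ∀ y m, PadicInt.toZModPow m (z y) = r m y := by
    intro y m
    have h := PadicInt.lift_spec (hfcompat y) m
    have h' := DFunLike.congr_fun h Polynomial.X
    rw [RingHom.comp_apply] at h'
    rw [show z y = PadicInt.lift (hfcompat y) Polynomial.X from rfl, h', hfX]
  -- additivity
  have hzadd : ∀ y y', z (y + y') = z y + z y' := by
    intro y y'
    refine PadicInt.ext_of_toZModPow.mp fun m ↦ ?_
    rw [map_add, hz, hz, hz, map_add]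
  have hz0 : z 0 = 0 := by
    have h := hzadd 0 0
    rw [add_zero] at h
    -- `z 0 = z 0 + z 0`
    have : z 0 + z 0 = z 0 + 0 := by rw [add_zero]; exact h.symm
    exact add_left_cancel this
  refine ⟨{ toFun := z, map_zero' := hz0, map_add' := hzadd }, fun y a ↦ ?_⟩
  change χ₀ y = _ ↔ PadicInt.toZModPow k (z y) = _
  rw [hz, ← hθk]
  exact hr k y a

/-! ## §4 Separation -/

/-- **`ℤ_p`-valued functionals detect `p^k N`.** Let `N` be an abelian group without `p`-torsion,
`n ∈ N`, `k ≥ 0`. If `n ∉ p^k N` then some additive `z : N → ℤ_p` has `p^k ∤ z(n)`. (Pontryagin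
duality for `N ⊗ ℚ_p/ℤ_p` and `Hom(N, ℤ_p)`: a character of `N/p^kN` non-zero at `n`, lifted to
`ℤ_p` by `exists_addMonoidHom_padicInt_lift_character`.)
[cite: NeukirchSchmidtWingberg2008, I §1 (1.1.8) (Pontryagin duality)] -/
theorem exists_addMonoidHom_padicInt_not_dvd (hN : ∀ y : N, p • y = 0 → y = 0) {k : ℕ} {n : N}
    (hn : ∀ y : N, p ^ k • y ≠ n) : ∃ z : N →+ ℤ_[p], ¬ (p : ℤ_[p]) ^ k ∣ z n := by
  -- the subgroup `p^k N` and the quotient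
  let S : AddSubgroup N := (DistribSMul.toAddMonoidHom N (p ^ k)).range
  have hS : ∀ y : N, p ^ k • y ∈ S := fun y ↦ ⟨y, rfl⟩
  have hnS : (QuotientAddGroup.mk n : N ⧸ S) ≠ 0 := by
    intro h
    rw [QuotientAddGroup.eq_zero_iff] at h
    obtain ⟨y, hy⟩ := h
    exact hn y hy
  -- a character of the quotient non-zero at `n`
  obtain ⟨χ, hχ⟩ := CharacterModule.exists_character_apply_ne_zero_of_ne_zero hnS
  let χ₀ : N →+ AddCircle (1 : ℚ) := (χ : (N ⧸ S) →+ AddCircle (1 : ℚ)).comp (QuotientAddGroup.mk' S)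
  have hχ₀n : χ₀ n ≠ 0 := hχ
  have hχ₀tors : ∀ y, p ^ k • χ₀ y = 0 := by
    intro y
    change p ^ k • (χ : (N ⧸ S) →+ AddCircle (1 : ℚ)) (QuotientAddGroup.mk' S y) = 0
    rw [← map_nsmul, ← map_nsmul, QuotientAddGroup.mk'_apply,
      (QuotientAddGroup.eq_zero_iff _).mpr (hS y), map_zero]
  -- lift it to `ℤ_p`
  obtain ⟨z, hz⟩ := exists_addMonoidHom_padicInt_lift_character hN χ₀ hχ₀tors
  refine ⟨z, fun hdvd ↦ hχ₀n ?_⟩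
  have h0 : PadicInt.toZModPow k (z n) = ((0 : ℤ) : ZMod (p ^ k)) := by
    rw [Int.cast_zero, ← RingHom.mem_ker, PadicInt.ker_toZModPow, Ideal.mem_span_singleton]
    exact hdvd
  rw [(hz n 0).mpr h0]
  simp

/-- **Contrapositive form**: on a `p`-torsion-free abelian group, an element on which every
`ℤ_p`-valued additive map is divisible by `p^k` lies in `p^k N`.
[cite: NeukirchSchmidtWingberg2008, I §1 (1.1.8) (Pontryagin duality)] -/
theorem exists_nsmul_eq_of_forall_addMonoidHom_padicInt_dvd (hN : ∀ y : N, p • y = 0 → y = 0)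
    {k : ℕ} {n : N} (h : ∀ z : N →+ ℤ_[p], (p : ℤ_[p]) ^ k ∣ z n) : ∃ y : N, p ^ k • y = n := by
  by_contra hne
  obtain ⟨z, hz⟩ := exists_addMonoidHom_padicInt_not_dvd hN (k := k) (n := n) fun y hy ↦ hne ⟨y, hy⟩
  exact hz (h z)

end Literature.Algebra.Module

end
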